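import Mathlib
import Summits.Ventures.PercRepro2.Defs
import Summits.Ventures.PercRepro2.Independence
import Summits.Ventures.PercRepro2.Harris

/-!
# The three-event covariance lemma on a principal decreasing event (blind cell PercRepro2, p4 g32;
proofs/P4-G32-STRUCTURE.md §2, Theorem A; S3 (G4-u) item (ap))

For increasing events `G, H` and a decreasing event `B` the cell's THREE-EVENT LEMMA reads
`Cov(G, H) ≥ Cov(↑(G ∩ B), B ∩ H)`. This file proves it when `B` is PRINCIPAL:
`B = allClosed F = {ω ∣ ω e = false on F}` (`= {ω ≤ y}` for `y = 1 off F`). Then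
`↑(G ∩ B) = M := {ω ∣ zeroOn F ω ∈ G}` (the restriction of `ω` to the edges off `F` lies in `G`),
a cylinder event, and `Cov(M, B ∩ H) = P(B) · Cov(M, H̃)` with `H̃ := {ω ∣ zeroOn F ω ∈ H}`.

**`cov_ge_prob_allClosed_mul_cov`**: `P(B) · (P(M ∩ H̃) − P(M) P(H̃)) ≤ P(G ∩ H) − P(G) P(H)`.
Proof: induction over the edges of `F`, pinning one edge `e ∈ F` at a time (`prob_eq_pin`):
`Cov_p(G,H) = a·Cov_{p[e↦1]} + (1−a)·Cov_{p[e↦0]} + a(1−a)·ΔG·ΔH ≥ (1−a)·Cov_{p[e↦0]}(G,H)`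
(Harris at `p[e↦1]`, monotonicity for the product), while `P_p(B) = (1−a) P_{p[e↦0]}(B)` and
`Cov(M, H̃)` does not see the edge `e`; at the end (`p ≡ 0` on `F`) both sides agree because the
configurations off `B` carry no weight. **`cov_inter_allClosed_le_cov`** is the literal form
`Cov(M, B ∩ H) ≤ Cov(G, H)`, via the independence of `B` (an `F`-event) and `M ∩ H̃` (an `Fᶜ`-event).
No instance, no notation, no sorry.
-/

namespace Summit.Ventures.PercRepro2

namespace ThreeEvent

section ZeroOn

variable {E : Type*} [DecidableEq E]

/-- `zeroOn F ω`: the configuration `ω` with every edge of `F` forced closed. -/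
def zeroOn (F : Finset E) (ω : Config E) : Config E := fun e => if e ∈ F then false else ω e

/-- Off `F`, `zeroOn F ω` agrees with `ω`. -/
lemma zeroOn_apply_of_notMem (F : Finset E) (ω : Config E) {e : E} (h : e ∉ F) :
    zeroOn F ω e = ω e := by
  simp [zeroOn, h]

/-- On `F`, `zeroOn F ω` is closed. -/
lemma zeroOn_apply_of_mem (F : Finset E) (ω : Config E) {e : E} (h : e ∈ F) :
    zeroOn F ω e = false := by
  simp [zeroOn, h]

/-- `zeroOn F ω ≤ ω`. -/
lemma zeroOn_le (F : Finset E) (ω : Config E) : zeroOn F ω ≤ ω := by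
  intro e
  by_cases h : e ∈ F
  · simp [zeroOn, h]
  · simp [zeroOn, h]

/-- `zeroOn F` is monotone. -/
lemma zeroOn_mono (F : Finset E) : Monotone (zeroOn F) := by
  intro ω ω' h e
  by_cases he : e ∈ F
  · simp [zeroOn, he]
  · simp only [zeroOn, he, if_false]
    exact h e

/-- On `allClosed F`, `zeroOn F` is the identity. -/
lemma zeroOn_eq_self_of_mem_allClosed (F : Finset E) {ω : Config E} (h : ω ∈ allClosed F) :
    zeroOn F ω = ω := by
  funext e
  by_cases he : e ∈ F
  · rw [zeroOn_apply_of_mem F ω he, (mem_allClosed.1 h) e he]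
  · exact zeroOn_apply_of_notMem F ω he

/-- `zeroOn F` does not see an edge of `F`. -/
lemma zeroOn_update_of_mem (F : Finset E) (ω : Config E) {e : E} (h : e ∈ F) (b : Bool) :
    zeroOn F (Function.update ω e b) = zeroOn F ω := by
  funext e'
  by_cases he' : e' = e
  · subst he'; simp [zeroOn, h]
  · simp [zeroOn, Function.update_of_ne he']

end ZeroOn

section Events

variable {E : Type*} [DecidableEq E]

/-- The cylinder event `M = {ω ∣ zeroOn F ω ∈ G}` (`= ↑(G ∩ allClosed F)` for an up-set `G`). -/
def restrictEvent (F : Finset E) (G : Set (Config E)) : Set (Config E) := {ω | zeroOn F ω ∈ G}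

/-- Membership in `restrictEvent`. -/
@[simp] lemma mem_restrictEvent {F : Finset E} {G : Set (Config E)} {ω : Config E} :
    ω ∈ restrictEvent F G ↔ zeroOn F ω ∈ G := Iff.rfl

/-- `restrictEvent F G` is increasing when `G` is. -/
lemma isUpperSet_restrictEvent (F : Finset E) {G : Set (Config E)} (hG : IsUpperSet G) :
    IsUpperSet (restrictEvent F G) := by
  intro ω ω' h hω
  exact hG (zeroOn_mono F h) hω

/-- `restrictEvent F G ⊆ G` for an up-set `G`. -/
lemma restrictEvent_subset (F : Finset E) {G : Set (Config E)} (hG : IsUpperSet G) :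
    restrictEvent F G ⊆ G := fun ω hω => hG (zeroOn_le F ω) hω

/-- On `allClosed F`, `restrictEvent F G` and `G` agree. -/
lemma restrictEvent_inter_allClosed (F : Finset E) (G : Set (Config E)) :
    restrictEvent F G ∩ allClosed F = G ∩ allClosed F := by
  ext ω
  constructor
  · rintro ⟨hM, hB⟩
    exact ⟨by simpa [restrictEvent, zeroOn_eq_self_of_mem_allClosed F hB] using hM, hB⟩
  · rintro ⟨hG, hB⟩
    exact ⟨by simpa [restrictEvent, zeroOn_eq_self_of_mem_allClosed F hB] using hG, hB⟩


/-- For an up-set `G`, `restrictEvent F G` is the up-closure of `G ∩ allClosed F`: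
`M = ↑(G ∩ B)` — the `M` of the three-event lemma. -/
lemma restrictEvent_eq_upperClosure (F : Finset E) {G : Set (Config E)} (hG : IsUpperSet G) :
    restrictEvent F G = {ω | ∃ z, z ∈ G ∧ z ∈ allClosed F ∧ z ≤ ω} := by
  ext ω
  constructor
  · intro hω
    exact ⟨zeroOn F ω, hω, fun e he => zeroOn_apply_of_mem F ω he, zeroOn_le F ω⟩
  · rintro ⟨z, hzG, hzB, hzω⟩
    have : z ≤ zeroOn F ω := by
      rw [← zeroOn_eq_self_of_mem_allClosed F hzB]
      exact zeroOn_mono F hzω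
    exact hG this hzG

/-- `restrictEvent F G` is determined by the edges off `F`. -/
lemma dependsOn_restrictEvent (F : Finset E) (G : Set (Config E)) :
    DependsOn (· ∈ restrictEvent F G) ((↑F : Set E)ᶜ) := by
  intro ω ω' h
  have : zeroOn F ω = zeroOn F ω' := by
    funext e
    by_cases he : e ∈ F
    · simp [zeroOn, he]
    · simp only [zeroOn, he, if_false]
      exact h e (by simpa using he)
  show (zeroOn F ω ∈ G) = (zeroOn F ω' ∈ G)
  rw [this]

omit [DecidableEq E] in
/-- `allClosed F` is determined by the edges of `F`. -/
lemma dependsOn_allClosed (F : Finset E) :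
    DependsOn (· ∈ allClosed F) (↑F : Set E) := by
  intro ω ω' h
  simp only [eq_iff_iff, mem_allClosed]
  constructor
  · intro hω e he
    rw [← h e (by simpa using he)]
    exact hω e he
  · intro hω e he
    rw [h e (by simpa using he)]
    exact hω e he

end Events

section Laws

variable {E : Type*} [Fintype E] [DecidableEq E] {R : Type*} [CommRing R]

/-- Pinning an edge of `F` closed does not change the law of an event determined off `F`. -/
lemma prob_update_zero_of_dependsOn_compl (p : E → R) {F : Finset E} {A : Set (Config E)}
    (hA : DependsOn (· ∈ A) ((↑F : Set E)ᶜ)) {e : E} (he : e ∈ F) :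
    prob (Function.update p e 0) A = prob p A := by
  rw [prob_eq_expect_indicator, prob_eq_expect_indicator, expect_update_zero]
  unfold expect
  refine Finset.sum_congr rfl fun ω _ => ?_
  congr 1
  show A.indicator (1 : Config E → R) (Function.update ω e false) = A.indicator 1 ω
  have hmem : Function.update ω e false ∈ A ↔ ω ∈ A := by
    refine dependsOn_mem_iff hA fun i hi => ?_
    have hie : i ≠ e := fun h => by subst h; exact hi (by simpa using he)
    simp [Function.update_of_ne hie]
  by_cases hω : ω ∈ A
  · rw [Set.indicator_of_mem (hmem.2 hω), Set.indicator_of_mem hω]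
    rfl
  · rw [Set.indicator_of_notMem (fun h => hω (hmem.1 h)), Set.indicator_of_notMem hω]

/-- `P_p(allClosed F) = (1 − p e) · P_{p[e↦0]}(allClosed F)` for `e ∈ F`. -/
lemma prob_allClosed_eq_pin_zero (p : E → R) {F : Finset E} {e : E} (he : e ∈ F) :
    prob p (allClosed F) = (1 - p e) * prob (Function.update p e 0) (allClosed F) := by
  rw [← prob_inter_closedEdge]
  congr 1
  ext ω
  constructor
  · intro h; exact ⟨h, (mem_allClosed.1 h) e he⟩
  · rintro ⟨h, _⟩; exact h

/-- When every edge of `F` is pinned closed, an event has the law of its restriction. -/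
lemma prob_eq_prob_restrictEvent_of_pinned {p : E → R} {F : Finset E}
    (hp0 : ∀ e ∈ F, p e = 0) (A : Set (Config E)) :
    prob p A = prob p (restrictEvent F A) := by
  unfold prob
  refine Finset.sum_congr rfl fun ω _ => ?_
  by_cases hω : ω ∈ allClosed F
  · have hmem : ω ∈ A ↔ ω ∈ restrictEvent F A := by
      rw [mem_restrictEvent, zeroOn_eq_self_of_mem_allClosed F hω]
    by_cases hA : ω ∈ A
    · rw [Set.indicator_of_mem hA, Set.indicator_of_mem (hmem.1 hA)]
    · rw [Set.indicator_of_notMem hA, Set.indicator_of_notMem (fun h => hA (hmem.2 h))]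
  · -- some edge of `F` is open in `ω`, so `ω` carries no weight
    have : ∃ e ∈ F, ω e = true := by
      by_contra hcon
      exact hω fun e he => by
        by_contra hne
        exact hcon ⟨e, he, by simpa using hne⟩
    obtain ⟨e, he, hωe⟩ := this
    have hw : weight p ω = 0 := by
      have h0 : Function.update p e 0 = p := by
        funext e'
        by_cases h : e' = e
        · rw [h, Function.update_self, hp0 e he]
        · rw [Function.update_of_ne h]
      rw [← h0]
      exact weight_update_zero_of_eq_true p hωe
    rw [Set.indicator_apply_eq_zero.2 fun _ => hw, Set.indicator_apply_eq_zero.2 fun _ => hw]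

omit [Fintype E] in
/-- The restriction of an intersection. -/
lemma restrictEvent_inter (F : Finset E) (A B : Set (Config E)) :
    restrictEvent F (A ∩ B) = restrictEvent F A ∩ restrictEvent F B := rfl

end Laws

section Main

variable {E : Type*} [Fintype E] [DecidableEq E] {R : Type*} [CommRing R] [LinearOrder R]
  [IsStrictOrderedRing R]

omit [LinearOrder R] [IsStrictOrderedRing R] in
/-- The covariance `P(X ∩ Y) − P(X) P(Y)`, pinned at an edge:
`Cov_p = a·Cov_{p[e↦1]} + (1 − a)·Cov_{p[e↦0]} + a(1 − a)·(P₁X − P₀X)(P₁Y − P₀Y)`. -/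
lemma cov_eq_pin (p : E → R) (X Y : Set (Config E)) (e : E) :
    prob p (X ∩ Y) - prob p X * prob p Y =
      p e * (prob (Function.update p e 1) (X ∩ Y)
          - prob (Function.update p e 1) X * prob (Function.update p e 1) Y)
      + (1 - p e) * (prob (Function.update p e 0) (X ∩ Y)
          - prob (Function.update p e 0) X * prob (Function.update p e 0) Y)
      + p e * (1 - p e) * ((prob (Function.update p e 1) X - prob (Function.update p e 0) X)
          * (prob (Function.update p e 1) Y - prob (Function.update p e 0) Y)) := by
  rw [prob_eq_pin p (X ∩ Y) e, prob_eq_pin p X e, prob_eq_pin p Y e]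
  ring

/-- For an increasing event, pinning an edge open dominates pinning it closed. -/
lemma prob_update_zero_le_prob_update_one {p : E → R} (hp : IsProbVec p) {A : Set (Config E)}
    (hA : IsUpperSet A) (e : E) :
    prob (Function.update p e 0) A ≤ prob (Function.update p e 1) A := by
  rw [prob_eq_expect_indicator, prob_eq_expect_indicator]
  exact expect_update_zero_le_expect_update_one hp (monotone_indicator_of_isUpperSet hA) e

/-- **Theorem A, inductive form**: with the edges of `F ∖ S` already pinned closed,
`P(allClosed F) · Cov(M, H̃) ≤ Cov(G, H)`. -/
theorem cov_ge_prob_allClosed_mul_cov_aux (F : Finset E) {G H : Set (Config E)}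
    (hG : IsUpperSet G) (hH : IsUpperSet H) (S : Finset E) :
    S ⊆ F → ∀ p : E → R, IsProbVec p → (∀ e ∈ F, e ∉ S → p e = 0) →
      prob p (allClosed F)
          * (prob p (restrictEvent F G ∩ restrictEvent F H)
              - prob p (restrictEvent F G) * prob p (restrictEvent F H))
        ≤ prob p (G ∩ H) - prob p G * prob p H := by
  classical
  induction S using Finset.induction_on with
  | empty =>
    intro _ p _ hp0
    have hp0' : ∀ e ∈ F, p e = 0 := fun e he => hp0 e he (Finset.notMem_empty e)
    have hB : prob p (allClosed F) = 1 := by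
      rw [prob_allClosed]
      exact Finset.prod_eq_one fun e he => by rw [hp0' e he, sub_zero]
    rw [hB, one_mul, prob_eq_prob_restrictEvent_of_pinned hp0' (G ∩ H),
      prob_eq_prob_restrictEvent_of_pinned hp0' G, prob_eq_prob_restrictEvent_of_pinned hp0' H,
      restrictEvent_inter]
  | insert e S' heS' ih =>
    intro hSF p hp hp0
    have heF : e ∈ F := hSF (Finset.mem_insert_self e S')
    have hS'F : S' ⊆ F := fun x hx => hSF (Finset.mem_insert_of_mem hx)
    set p₀ := Function.update p e 0 with hp₀
    set p₁ := Function.update p e 1 with hp₁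
    have hp0' : IsProbVec p₀ := hp.update e le_rfl zero_le_one
    have hp1' : IsProbVec p₁ := hp.update e zero_le_one le_rfl
    have hpin₀ : ∀ e' ∈ F, e' ∉ S' → p₀ e' = 0 := by
      intro e' he' hne
      by_cases h : e' = e
      · subst h; simp [hp₀]
      · rw [hp₀, Function.update_of_ne h]
        exact hp0 e' he' fun hmem => (Finset.mem_insert.1 hmem).elim h hne
    have hIH := ih hS'F p₀ hp0' hpin₀
    -- the three pinning facts
    have hB : prob p (allClosed F) = (1 - p e) * prob p₀ (allClosed F) :=
      prob_allClosed_eq_pin_zero p heF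
    have hM : prob p₀ (restrictEvent F G) = prob p (restrictEvent F G) :=
      prob_update_zero_of_dependsOn_compl p (dependsOn_restrictEvent F G) heF
    have hH' : prob p₀ (restrictEvent F H) = prob p (restrictEvent F H) :=
      prob_update_zero_of_dependsOn_compl p (dependsOn_restrictEvent F H) heF
    have hdep : DependsOn (· ∈ restrictEvent F G ∩ restrictEvent F H) ((↑F : Set E)ᶜ) :=
      DependsOn.mono (fun x hx => hx.elim id id)
        (dependsOn_inter (dependsOn_restrictEvent F G) (dependsOn_restrictEvent F H))
    have hMH : prob p₀ (restrictEvent F G ∩ restrictEvent F H)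
        = prob p (restrictEvent F G ∩ restrictEvent F H) :=
      prob_update_zero_of_dependsOn_compl p hdep heF
    -- the one-edge decomposition of the covariance of `G` and `H`
    have hcov := cov_eq_pin p G H e
    have ha0 : 0 ≤ p e := hp.nonneg e
    have ha1 : 0 ≤ 1 - p e := sub_nonneg.2 (hp.le_one e)
    have hharris : 0 ≤ prob p₁ (G ∩ H) - prob p₁ G * prob p₁ H :=
      sub_nonneg.2 (prob_mul_prob_le_prob_inter hp1' hG hH)
    have hdG : 0 ≤ prob p₁ G - prob p₀ G :=
      sub_nonneg.2 (prob_update_zero_le_prob_update_one hp hG e)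
    have hdH : 0 ≤ prob p₁ H - prob p₀ H :=
      sub_nonneg.2 (prob_update_zero_le_prob_update_one hp hH e)
    have hstep : (1 - p e) * (prob p₀ (G ∩ H) - prob p₀ G * prob p₀ H)
        ≤ prob p (G ∩ H) - prob p G * prob p H := by
      rw [hcov]
      have h1 : 0 ≤ p e * (prob p₁ (G ∩ H) - prob p₁ G * prob p₁ H) := mul_nonneg ha0 hharris
      have h2 : 0 ≤ p e * (1 - p e) * ((prob p₁ G - prob p₀ G) * (prob p₁ H - prob p₀ H)) :=
        mul_nonneg (mul_nonneg ha0 ha1) (mul_nonneg hdG hdH)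
      linarith
    calc prob p (allClosed F)
          * (prob p (restrictEvent F G ∩ restrictEvent F H)
              - prob p (restrictEvent F G) * prob p (restrictEvent F H))
        = (1 - p e) * (prob p₀ (allClosed F)
            * (prob p₀ (restrictEvent F G ∩ restrictEvent F H)
                - prob p₀ (restrictEvent F G) * prob p₀ (restrictEvent F H))) := by
          rw [hB, hM, hH', hMH]; ring
      _ ≤ (1 - p e) * (prob p₀ (G ∩ H) - prob p₀ G * prob p₀ H) :=
          mul_le_mul_of_nonneg_left hIH ha1
      _ ≤ prob p (G ∩ H) - prob p G * prob p H := hstep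

/-- **Theorem A (the three-event lemma on a principal decreasing event)**: for increasing `G, H`,
`B = allClosed F`, `M = restrictEvent F G = ↑(G ∩ B)` and `H̃ = restrictEvent F H`,
`P(B) · (P(M ∩ H̃) − P(M) P(H̃)) ≤ P(G ∩ H) − P(G) P(H)`. -/
theorem cov_ge_prob_allClosed_mul_cov {p : E → R} (hp : IsProbVec p) (F : Finset E)
    {G H : Set (Config E)} (hG : IsUpperSet G) (hH : IsUpperSet H) :
    prob p (allClosed F)
        * (prob p (restrictEvent F G ∩ restrictEvent F H)
            - prob p (restrictEvent F G) * prob p (restrictEvent F H))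
      ≤ prob p (G ∩ H) - prob p G * prob p H :=
  cov_ge_prob_allClosed_mul_cov_aux F hG hH F le_rfl p hp fun _ he hne => (hne he).elim

/-- **Theorem A, literal form**: `Cov(M, B ∩ H) ≤ Cov(G, H)` with `B = allClosed F` and
`M = restrictEvent F G` (`= ↑(G ∩ B)`; note `M ∩ B ∩ H = G ∩ B ∩ H`). -/
theorem cov_inter_allClosed_le_cov {p : E → R} (hp : IsProbVec p) (F : Finset E)
    {G H : Set (Config E)} (hG : IsUpperSet G) (hH : IsUpperSet H) :
    prob p (restrictEvent F G ∩ (allClosed F ∩ H))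
        - prob p (restrictEvent F G) * prob p (allClosed F ∩ H)
      ≤ prob p (G ∩ H) - prob p G * prob p H := by
  classical
  have key := cov_ge_prob_allClosed_mul_cov hp F hG hH
  -- independence of the `F`-event `allClosed F` and the `Fᶜ`-events
  have hdep : DependsOn (· ∈ restrictEvent F G ∩ restrictEvent F H) ((↑F : Set E)ᶜ) :=
    DependsOn.mono (fun x hx => hx.elim id id)
      (dependsOn_inter (dependsOn_restrictEvent F G) (dependsOn_restrictEvent F H))
  have h1 : prob p (allClosed F ∩ (restrictEvent F G ∩ restrictEvent F H))
      = prob p (allClosed F) * prob p (restrictEvent F G ∩ restrictEvent F H) :=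
    prob_inter_eq_mul_of_dependsOn_compl p (↑F : Set E) (dependsOn_allClosed F) hdep
  have h2 : prob p (allClosed F ∩ restrictEvent F H)
      = prob p (allClosed F) * prob p (restrictEvent F H) :=
    prob_inter_eq_mul_of_dependsOn_compl p (↑F : Set E) (dependsOn_allClosed F)
      (dependsOn_restrictEvent F H)
  -- on `allClosed F` the restrictions agree with the events
  have e1 : restrictEvent F G ∩ (allClosed F ∩ H)
      = allClosed F ∩ (restrictEvent F G ∩ restrictEvent F H) := by
    ext ω
    simp only [Set.mem_inter_iff, mem_restrictEvent]
    constructor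
    · rintro ⟨hM, hB, hHω⟩
      exact ⟨hB, hM, by rwa [zeroOn_eq_self_of_mem_allClosed F hB]⟩
    · rintro ⟨hB, hM, hH'⟩
      exact ⟨hM, hB, by rwa [zeroOn_eq_self_of_mem_allClosed F hB] at hH'⟩
  have e2 : allClosed F ∩ H = allClosed F ∩ restrictEvent F H := by
    ext ω
    simp only [Set.mem_inter_iff, mem_restrictEvent]
    constructor
    · rintro ⟨hB, hHω⟩
      exact ⟨hB, by rwa [zeroOn_eq_self_of_mem_allClosed F hB]⟩
    · rintro ⟨hB, hH'⟩
      exact ⟨hB, by rwa [zeroOn_eq_self_of_mem_allClosed F hB] at hH'⟩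
  rw [e1, e2, h1, h2]
  calc prob p (allClosed F) * prob p (restrictEvent F G ∩ restrictEvent F H)
        - prob p (restrictEvent F G) * (prob p (allClosed F) * prob p (restrictEvent F H))
      = prob p (allClosed F)
          * (prob p (restrictEvent F G ∩ restrictEvent F H)
              - prob p (restrictEvent F G) * prob p (restrictEvent F H)) := by ring
    _ ≤ prob p (G ∩ H) - prob p G * prob p H := key

end Main

end ThreeEvent

end Summit.Ventures.PercRepro2
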